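import Literature.Computability.Complexity.TodaWitnessCount
import Literature.Computability.Complexity.BinarySearchPP
import Literature.Computability.Complexity.ParityQuantifier
import HarnessLib

/-!
# Toda's theorem, second half: `BP·⊕P ⊆ P^{PP}` (discharge of `bp_ParityP_subset_PRelClass_PP`)

Topic `Computability/Complexity` (counting classes). This file proves the named fact
`bp_ParityP_subset_PRelClass_PP` of `ParityQuantifier.lean` — Arora–Barak 2009, proof of
Thm. 17.14 from Lemma 17.22 (p. 423: "… the resulting deterministic polynomial-time computation
makes a single `#SAT` query"); Toda 1991, §4 — as `bp_ParityP_subset_PRelClass_PP_holds`, from: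

* `TodaWitnessLanguage.lean` / `TodaWitnessCount.lean`: the witness language `todaLang W p q ∈ P`
  whose counts on `⟨x, [1]⟩`, `⟨x, [0]⟩` are `S⁺ = Σ_y A⁺_ℓ(#W(x,y))`, `S⁻ = Σ_y A⁻_ℓ(#W(x,y))`
  (`count_todaLang`), `ℓ = m + 1`;
* `ModulusAmplification.lean`: `Σ_y (A⁺ − A⁻)(#W(x,y)) ≡ N (mod 2^ℓ)`, `N = #{y | #W(x,y) odd}`
  (`ModAmp.sum_amplified_modEq`);
* `BinarySearchPP.lean` (with `ThresholdPP.lean`, `AdaptiveQueries.lean`): a `P^{PP}` machine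
  obtains `S⁺`, `S⁻` digit by digit and applies a polynomial-time post-processing language
  (`BinSearchPP.countsLang_mem_PRelClass_PP`) — here `ELang p`: "`2^m < 2·((S⁺ mod 2^ℓ +
  (2^ℓ − S⁻ mod 2^ℓ)) mod 2^ℓ)`", i.e. `2N > 2^m` (`mem_ELang_iff`, `mod_recombine`), assembled
  from the arithmetic bricks `Brick.addFn`/`subFn`/`ltFn` and `truncSndFn` (`bitsToNat_take`).

Since `N ≤ 2^m < 2^ℓ`, `N` is recovered exactly, and by the `BP·` promise (`2/3`) `x ∈ L ↔ 2N > 2^m`.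
Arora–Barak obtain one `#SAT` query and quote `P^{#SAT} ⊆ P^{PP}`; here the two `#P` values are
read through the `PP` threshold oracle directly (two binary searches), which is the same machine.

## References

* S. Arora, B. Barak, *Computational Complexity: A Modern Approach*, CUP 2009, Thm. 17.14 and its
  proof (p. 423), Lemma 17.22, §17.2.1 (Lemma 17.7).
* S. Toda, *PP is as hard as the polynomial-time hierarchy*, SIAM J. Comput. 20 (1991), §4.
-/

namespace Literature.Computability.Complexity

open _root_.Computability Polynomial PRelSigma OracleCompose TTClosure Finset

namespace TodaPartTwo

/-! ### Arithmetic on little-endian numerals -/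

/-- `val` of a prefix is the remainder by a power of two. [folklore] -/
theorem bitsToNat_take : ∀ (l : List Bool) (k : ℕ), bitsToNat (l.take k) = bitsToNat l % 2 ^ k
  | [], k => by simp
  | b :: l, 0 => by simp [Nat.mod_one]
  | b :: l, k + 1 => by
    rw [List.take_succ_cons, bitsToNat_cons, bitsToNat_cons, bitsToNat_take l k, pow_succ]
    have h := Nat.div_add_mod (bitsToNat l) (2 ^ k)
    have hr : bitsToNat l % 2 ^ k < 2 ^ k := Nat.mod_lt _ (Nat.two_pow_pos k)
    have hb : b.toNat ≤ 1 := Bool.toNat_le b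
    set P := 2 ^ k
    set R := bitsToNat l % P
    set Q := bitsToNat l / P
    rw [show b.toNat + 2 * bitsToNat l = b.toNat + 2 * R + (P * 2) * Q by rw [← h]; ring, Nat.add_mul_mod_self_left,
      Nat.mod_eq_of_lt (by omega)]

/-- `val(0ʳ 1) = 2ʳ`. [folklore] -/
theorem bitsToNat_zeros_one (r : ℕ) : bitsToNat (List.replicate r false ++ [true]) = 2 ^ r := by
  rw [bitsToNat_append, bitsToNat_replicate_false, List.length_replicate]; simp

/-! ### The post-processing test `2^m < 2·((S⁺ mod 2^ℓ + 2^ℓ − S⁻ mod 2^ℓ) mod 2^ℓ)` -/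

section Test

variable (p : Polynomial ℕ)

/-- The numeral `0^{r(|x|)} 1` of `2^{r(|x|)}` (`x = fstP z`). [folklore] -/
noncomputable def twoPow (r : Polynomial ℕ) : List Bool → List Bool :=
  concatFn ∘ pairFn (Kannan.zerosFn ∘ padFn r) fun _ => [true]

/-- The low `ℓ = m + 1` digits of the numeral returned by `f`. [folklore] -/
noncomputable def lowL (f : List Bool → List Bool) : List Bool → List Bool := sndP ∘ truncSndFn (p + 1) ∘ pairFn fstP f

/-- The numeral of `S⁺ mod 2^ℓ + (2^ℓ − S⁻ mod 2^ℓ)`. [folklore] -/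
noncomputable def sumFn : List Bool → List Bool :=
  Brick.addFn ∘ pairFn (lowL p (fstP ∘ sndP)) (Brick.subFn ∘ pairFn (twoPow (p + 1)) (lowL p (sndP ∘ sndP)))

/-- The numeral of `2N`, `N = (…) mod 2^ℓ`. [folklore] -/
noncomputable def twoNFn : List Bool → List Bool := List.cons false ∘ lowL p (sumFn p)

/-- **The post-processing language**: `2^m < 2N`. [cite: AroraBarak2009, Thm. 17.14 (proof)] -/
noncomputable def ELang : Language Bool := (Brick.ltFn ∘ pairFn (twoPow p) (twoNFn p)) ⁻¹' HeadIs true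

variable {p}

/-- `twoPow r ∈ FP`. [folklore] -/
theorem twoPow_mem_FP (r : Polynomial ℕ) : twoPow r ∈ FP :=
  comp_mem_FP concatFn_mem_FP (pairFn_mem_FP (comp_mem_FP Kannan.zerosFn_mem_FP (padFn_mem_FP r)) (const_mem_FP _))

/-- `lowL p f ∈ FP` for `f ∈ FP`. [folklore] -/
theorem lowL_mem_FP {f : List Bool → List Bool} (hf : f ∈ FP) : lowL p f ∈ FP :=
  comp_mem_FP sndP_mem_FP (comp_mem_FP (truncSndFn_mem_FP _) (pairFn_mem_FP fstP_mem_FP hf))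

/-- `sumFn p ∈ FP`. [folklore] -/
theorem sumFn_mem_FP : sumFn p ∈ FP :=
  comp_mem_FP Brick.addFn_mem_FP (pairFn_mem_FP (lowL_mem_FP (comp_mem_FP fstP_mem_FP sndP_mem_FP))
    (comp_mem_FP Brick.subFn_mem_FP (pairFn_mem_FP (twoPow_mem_FP _) (lowL_mem_FP (comp_mem_FP sndP_mem_FP sndP_mem_FP)))))

/-- **`ELang p ∈ P`.** [folklore] -/
theorem ELang_mem_P : ELang p ∈ Classes.P :=
  preimage_mem_P (HeadIs_mem_P true) (comp_mem_FP Brick.ltFn_mem_FP (pairFn_mem_FP (twoPow_mem_FP _)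
    (comp_mem_FP (cons_mem_FP false) (lowL_mem_FP sumFn_mem_FP))))

/-- Value of `twoPow`. [folklore] -/
theorem bitsToNat_twoPow (r : Polynomial ℕ) (x v : List Bool) : bitsToNat (twoPow r (boolPair x v)) = 2 ^ r.eval x.length := by
  simp [twoPow, padFn_apply, Kannan.zerosFn_apply, bitsToNat_zeros_one]

/-- Value of `lowL`. [folklore] -/
theorem bitsToNat_lowL (f : List Bool → List Bool) (x v : List Bool) :
    bitsToNat (lowL p f (boolPair x v)) = bitsToNat (f (boolPair x v)) % 2 ^ (p.eval x.length + 1) := by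
  simp [lowL, truncSndFn_boolPair, bitsToNat_take]

/-- **Semantics of the post-processing language** on `⟨x, ⟨ν₁, ν₀⟩⟩`:
`2^m < 2·((val ν₁ mod 2^ℓ + (2^ℓ − val ν₀ mod 2^ℓ)) mod 2^ℓ)`. [cite: AroraBarak2009, Thm. 17.14 (proof)] -/
theorem mem_ELang_iff (x ν₁ ν₀ : List Bool) :
    boolPair x (boolPair ν₁ ν₀) ∈ ELang p ↔
      2 ^ p.eval x.length < 2 * ((bitsToNat ν₁ % 2 ^ (p.eval x.length + 1) +
        (2 ^ (p.eval x.length + 1) - bitsToNat ν₀ % 2 ^ (p.eval x.length + 1))) % 2 ^ (p.eval x.length + 1)) := by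
  simp only [ELang, memL_preimage, Function.comp_apply, pairFn_apply, Brick.ltFn_boolPair, mem_HeadIs,
    bitsToNat_twoPow, twoNFn, bitsToNat_cons, sumFn, Brick.addFn_boolPair, Brick.subFn_boolPair,
    bitsToNat_encodeNat, bitsToNat_lowL, sndP_boolPair, fstP_boolPair, eval_add, eval_one, List.head?_cons,
    Option.some.injEq, decide_eq_true_eq, Bool.toNat_false, Nat.zero_add]

end Test

/-! ### Assembly -/

/-- Integer bookkeeping: if `(S⁺ : ℤ) − S⁻ ≡ N (mod M)` and `N < M` then
`(S⁺ mod M + (M − S⁻ mod M)) mod M = N`. [folklore] -/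
theorem mod_recombine {Sp Sn N M : ℕ} (hM : 0 < M) (h : (Sp : ℤ) - Sn ≡ N [ZMOD M]) (hN : N < M) :
    (Sp % M + (M - Sn % M)) % M = N := by
  have h1 : ((Sp % M + (M - Sn % M) : ℕ) : ℤ) ≡ N [ZMOD M] := by
    have hSn : Sn % M ≤ M := (Nat.mod_lt _ hM).le
    push_cast [Nat.cast_sub hSn]
    have e1 : ((Sp % M : ℕ) : ℤ) ≡ Sp [ZMOD M] := by
      rw [Int.ModEq, Int.natCast_mod, Int.emod_emod_of_dvd _ (dvd_refl _)]
    have e2 : ((Sn % M : ℕ) : ℤ) ≡ Sn [ZMOD M] := by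
      rw [Int.ModEq, Int.natCast_mod, Int.emod_emod_of_dvd _ (dvd_refl _)]
    have e3 : ((M : ℕ) : ℤ) ≡ 0 [ZMOD M] := by simp [Int.ModEq]
    calc ((Sp % M : ℕ) : ℤ) + ((M : ℤ) - ((Sn % M : ℕ) : ℤ)) ≡ Sp + (0 - Sn) [ZMOD M] :=
          Int.ModEq.add e1 (Int.ModEq.sub e3 e2)
      _ = Sp - Sn := by ring
      _ ≡ N [ZMOD M] := h
  have h2 := h1.eq
  rw [← Int.natCast_mod, ← Int.natCast_mod, Nat.mod_eq_of_lt hN] at h2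
  exact_mod_cast h2

/-- Real-to-natural bookkeeping for the `BP·` promise: `2/3 ≤ cnt/2^m ↔ 2·2^m ≤ 3·cnt`. [folklore] -/
theorem two_thirds_le_uniformProb_iff (m : ℕ) (E : Set (List Bool)) :
    (2 / 3 : ℝ) ≤ uniformProb m E ↔ 2 * 2 ^ m ≤ 3 * cnt m E := by
  rw [uniformProb_eq_cnt_div, le_div_iff₀ (by positivity)]
  constructor
  · intro h
    have : ((2 * 2 ^ m : ℕ) : ℝ) ≤ ((3 * cnt m E : ℕ) : ℝ) := by push_cast; linarith
    exact_mod_cast this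
  · intro h
    have : ((2 * 2 ^ m : ℕ) : ℝ) ≤ ((3 * cnt m E : ℕ) : ℝ) := by exact_mod_cast h
    push_cast at this; linarith

open TodaCount in
/-- **Toda's theorem, second half: `BP·⊕P ⊆ P^{PP}`** — discharge of the named fact
`bp_ParityP_subset_PRelClass_PP` (`ParityQuantifier.lean`). Given `L ∈ BP·⊕P` with coins
`y ∈ {0,1}^m` and parity language `{z | #W(z) odd}`, the `P^{PP}` machine obtains by binary search
(`BinarySearchPP.countsLang_mem_PRelClass_PP`) the two counts `S⁺ = Σ_y A⁺_ℓ(#W(x,y))`,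
`S⁻ = Σ_y A⁻_ℓ(#W(x,y))` of the witness language `todaLang` (`count_todaLang`), recovers
`N = #{y | #W(x,y) odd} = (S⁺ − S⁻) mod 2^ℓ` (`ModAmp.sum_amplified_modEq`, `N ≤ 2^m < 2^ℓ`,
`ℓ = m + 1`) and accepts iff `2N > 2^m`, which is membership in `L` by the `2/3`-promise.
(Arora–Barak 2009, proof of Thm. 17.14 from Lemma 17.22, p. 423; Toda 1991, §4.)
[cite: AroraBarak2009, Thm. 17.14 (proof)] -/
theorem bp_ParityP_subset_PRelClass_PP_holds : bp_ParityP_subset_PRelClass_PP := by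
  rintro L ⟨L', ⟨W, hW, q, hpar⟩, p, hbp⟩
  -- the `P^{PP}` language of the two counts with the post-processing `ELang p`
  have hmem := BinSearchPP.countsLang_mem_PRelClass_PP (V := todaLang W p q) (E := ELang p)
    (todaLang_mem_P hW) ELang_mem_P (LwP p q)
  suffices hEq : L = {x | boolPair x (boolPair (natBits ((LwP p q).eval x.length + 1)
      (ThresholdPP.cntV (todaLang W p q) (LwP p q) x [true]))
      (natBits ((LwP p q).eval x.length + 1) (ThresholdPP.cntV (todaLang W p q) (LwP p q) x [false]))) ∈ ELang p} by
    rw [hEq]; exact hmem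
  ext x
  change x ∈ L ↔ boolPair x (boolPair (natBits ((LwP p q).eval x.length + 1)
      (ThresholdPP.cntV (todaLang W p q) (LwP p q) x [true]))
      (natBits ((LwP p q).eval x.length + 1) (ThresholdPP.cntV (todaLang W p q) (LwP p q) x [false]))) ∈ ELang p
  -- the two counts (`m = p(|x|)`, `ℓ = m + 1`, `c y = #W(x, y)`)
  have hSp : ThresholdPP.cntV (todaLang W p q) (LwP p q) x [true] =
      ∑ y : List.Vector Bool (p.eval x.length), ModAmp.Apos (p.eval x.length + 1) (cW W p q x y.toList) := by
    have h := count_todaLang (W := W) (p := p) (q := q) (x := x) (b := true)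
    simp only [if_true] at h
    exact h
  have hSn : ThresholdPP.cntV (todaLang W p q) (LwP p q) x [false] =
      ∑ y : List.Vector Bool (p.eval x.length), ModAmp.Aneg (p.eval x.length + 1) (cW W p q x y.toList) := by
    have h := count_todaLang (W := W) (p := p) (q := q) (x := x) (b := false)
    simp only [Bool.false_eq_true, if_false] at h
    exact h
  -- `N = #{y | #W(x,y) odd}` and the modular identity
  have hNle : ((univ : Finset (List.Vector Bool (p.eval x.length))).filter fun y => Odd (cW W p q x y.toList)).card ≤
      2 ^ p.eval x.length := by
    have := card_filter_le (univ : Finset (List.Vector Bool (p.eval x.length))) (fun y => Odd (cW W p q x y.toList))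
    rwa [card_univ, card_vector, Fintype.card_bool] at this
  have hNlt : ((univ : Finset (List.Vector Bool (p.eval x.length))).filter fun y => Odd (cW W p q x y.toList)).card <
      2 ^ (p.eval x.length + 1) := by
    rw [pow_succ]; have := Nat.two_pow_pos (p.eval x.length); omega
  have hmod : ((∑ y : List.Vector Bool (p.eval x.length), ModAmp.Apos (p.eval x.length + 1) (cW W p q x y.toList) : ℕ) : ℤ) -
      (∑ y : List.Vector Bool (p.eval x.length), ModAmp.Aneg (p.eval x.length + 1) (cW W p q x y.toList) : ℕ) ≡
      ((univ : Finset (List.Vector Bool (p.eval x.length))).filter fun y => Odd (cW W p q x y.toList)).card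
        [ZMOD 2 ^ (p.eval x.length + 1)] := by
    have h := ModAmp.sum_amplified_modEq (p.eval x.length + 1) (univ : Finset (List.Vector Bool (p.eval x.length)))
      (fun y => cW W p q x y.toList)
    push_cast
    rw [← sum_sub_distrib]
    exact_mod_cast h
  have hval := mod_recombine (Nat.two_pow_pos (p.eval x.length + 1)) hmod hNlt
  -- `N` as a coin count of the parity event
  have hNcnt : ((univ : Finset (List.Vector Bool (p.eval x.length))).filter fun y => Odd (cW W p q x y.toList)).card =
      cnt (p.eval x.length) {y | Odd (countWitnesses W (q.eval (boolPair x y).length) (boolPair x y))} := by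
    unfold cnt
    refine card_equiv (Equiv.refl _) fun y => ?_
    simp only [Equiv.refl_apply, mem_filter, mem_univ, true_and, Set.mem_setOf_eq, length_boolPair,
      List.Vector.toList_length]
    rw [cW, eval_wP]; rfl
  -- the promise at `x`
  have hprom := hbp x
  rw [two_thirds_le_uniformProb_iff] at hprom
  -- the numerals are exact (`S < 2^{Lw} < 2^{Lw+1}`)
  have hlt : ∀ t : List Bool, ThresholdPP.cntV (todaLang W p q) (LwP p q) x t < 2 ^ ((LwP p q).eval x.length + 1) := by
    intro t
    have := cnt_le ((LwP p q).eval x.length) {u | boolPair (boolPair x t) u ∈ todaLang W p q}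
    have hpos := Nat.two_pow_pos ((LwP p q).eval x.length)
    change cnt ((LwP p q).eval x.length) {u | boolPair (boolPair x t) u ∈ todaLang W p q} < _
    rw [pow_succ]; omega
  -- membership
  rw [mem_ELang_iff, bitsToNat_natBits (hlt _), bitsToNat_natBits (hlt _), hSp, hSn, hval]
  constructor
  · intro hx
    have hE : cnt (p.eval x.length) {y : List Bool | boolPair x y ∈ L' ↔ x ∈ L} =
        ((univ : Finset (List.Vector Bool (p.eval x.length))).filter fun y => Odd (cW W p q x y.toList)).card := by
      rw [hNcnt]; exact cnt_congr fun y _ => by simp only [Set.mem_setOf_eq, hpar, hx, iff_true]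
    rw [hE] at hprom
    omega
  · intro h2N
    by_contra hx
    have hE : cnt (p.eval x.length) {y : List Bool | boolPair x y ∈ L' ↔ x ∈ L} =
        2 ^ p.eval x.length - ((univ : Finset (List.Vector Bool (p.eval x.length))).filter fun y => Odd (cW W p q x y.toList)).card := by
      rw [hNcnt, ← cnt_add_cnt_compl (p.eval x.length) {y | Odd (countWitnesses W (q.eval (boolPair x y).length) (boolPair x y))},
        Nat.add_sub_cancel_left]
      exact cnt_congr fun y _ => by simp only [Set.mem_setOf_eq, hpar, hx, iff_false, Set.mem_compl_iff]
    rw [hE] at hprom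
    omega

end TodaPartTwo

/-- **Toda's theorem, second half** in the tree's namespace of the named fact: `BP·⊕P ⊆ P^{PP}`.
[cite: AroraBarak2009, Thm. 17.14 (proof)] -/
theorem bp_ParityP_subset_PRelClass_PP_holds : bp_ParityP_subset_PRelClass_PP :=
  TodaPartTwo.bp_ParityP_subset_PRelClass_PP_holds

end Literature.Computability.Complexity
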